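import Mathlib
import Summits.Ventures.HodgeRepro2.T7SupportSplitOrbit

/-!
# Tier7/Line3/SplitOrbitBox — the split-place orbital integral of a general `γ` is a box count (seat t7-x1)

LINE 3 (t7-plan-3), version-(ii), the finite factors off the dominant term (`b_bound`, STATUS l. 15010): at a
split place the double-torus orbital integral of `1_{GL₂(O)}` at `γ = !![a, b; c, d]` (all entries and the
determinant non-zero) is supported, in the coordinates of p1's `T7SupportSplitOrbit` (`t = diagonal (1, t₂)`,
`s = diagonal (s₁, s₂)`), on the BOX
  `v(d) / v(det) ≤ v(s₁) ≤ v(a)⁻¹`,  `v(c) / v(det) ≤ v(s₂) ≤ v(b)⁻¹`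
of the value group (`mem_box_of_mem_K`; `v(t₂) = v(det) v(s₁) v(s₂)` is forced, `t₂_eq_of_mem_K`). For the unit
`γ₀` of §2c the box is the single point `(1, 1)` (p1's `units_of_mem_K`); in general, for a discrete valuation, it
has `(1 + e₁)(1 + e₂)` points, `e₁ = ord(a d / det)`, `e₂ = ord(b c / det)` (`card_box`, value group `ℤᵐ⁰`) —
the finite factor never exceeds a box count, which is what the divisor-bound estimate of l. 15010 (2) consumes.

Pure algebra over a valued field; the measure and the characters are not here. Blind lane: Mathlib + the
HodgeRepro2 prefix only; no sorry; axioms ⊆ {propext, Classical.choice, Quot.sound}.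
-/

namespace Summit.Ventures.HodgeRepro2.Tier7.Line3.SplitOrbitBox

open Matrix Summit.Ventures.HodgeRepro2.T7SupportSplitOrbit

variable {F : Type*} [Field F] {Γ₀ : Type*} [LinearOrderedCommGroupWithZero Γ₀]

/-- **the support of `(t, s) ↦ 1_{GL₂(O)}(t⁻¹ γ s)` lies in a box**: for `γ = !![a, b; c, d]` with `a`, `b` and
the determinant non-zero, `t⁻¹ γ s ∈ GL₂(O)` forces `v(d)/v(det) ≤ v(s₁) ≤ v(a)⁻¹`, `v(c)/v(det) ≤ v(s₂) ≤ v(b)⁻¹`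
and `v(t₂) = v(det) v(s₁) v(s₂)`. -/
theorem mem_box_of_mem_K (v : Valuation F Γ₀) (a b c d t₂ s₁ s₂ : F)
    (ha : a ≠ 0) (hb : b ≠ 0) (hdet : a * d - b * c ≠ 0)
    (ht : t₂ ≠ 0) (hs₁ : s₁ ≠ 0) (hs₂ : s₂ ≠ 0)
    (hK : MemK v (diagonal ![1, t₂⁻¹] * !![a, b; c, d] * diagonal ![s₁, s₂])) :
    (v d / v (a * d - b * c) ≤ v s₁ ∧ v s₁ ≤ (v a)⁻¹) ∧
      (v c / v (a * d - b * c) ≤ v s₂ ∧ v s₂ ≤ (v b)⁻¹) ∧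
      v t₂ = v (a * d - b * c) * (v s₁ * v s₂) := by
  obtain ⟨hint, hdet'⟩ := hK
  rw [conj_entries] at hint hdet'
  have h00 : v (a * s₁) ≤ 1 := by simpa using hint 0 0
  have h01 : v (b * s₂) ≤ 1 := by simpa using hint 0 1
  have h10 : v (c * s₁ / t₂) ≤ 1 := by simpa using hint 1 0
  have h11 : v (d * s₂ / t₂) ≤ 1 := by simpa using hint 1 1
  rw [Matrix.det_fin_two_of] at hdet'
  have hdet2 : v (a * d - b * c) * (v s₁ * v s₂) / v t₂ = 1 := by
    have e : a * s₁ * (d * s₂ / t₂) - b * s₂ * (c * s₁ / t₂) = (a * d - b * c) * (s₁ * s₂) / t₂ := by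
      field_simp
    rw [e, Valuation.map_div, Valuation.map_mul, Valuation.map_mul] at hdet'
    exact hdet'
  have hz0 : v t₂ ≠ 0 := (Valuation.ne_zero_iff v).2 ht
  have hx0 : v s₁ ≠ 0 := (Valuation.ne_zero_iff v).2 hs₁
  have hy0 : v s₂ ≠ 0 := (Valuation.ne_zero_iff v).2 hs₂
  have ha0 : v a ≠ 0 := (Valuation.ne_zero_iff v).2 ha
  have hb0 : v b ≠ 0 := (Valuation.ne_zero_iff v).2 hb
  have hD0 : v (a * d - b * c) ≠ 0 := (Valuation.ne_zero_iff v).2 hdet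
  have hDpos : 0 < v (a * d - b * c) := lt_of_le_of_ne zero_le hD0.symm
  have hzpos : 0 < v t₂ := lt_of_le_of_ne zero_le hz0.symm
  -- `v t₂ = v(det) v s₁ v s₂`
  have hZ : v t₂ = v (a * d - b * c) * (v s₁ * v s₂) := by
    rw [div_eq_one_iff_eq hz0] at hdet2
    exact hdet2.symm
  -- upper bounds from the first row
  have hX_hi : v s₁ ≤ (v a)⁻¹ := by
    rw [Valuation.map_mul] at h00
    have h := mul_le_mul_right h00 (v a)⁻¹
    rwa [inv_mul_cancel_left₀ ha0, mul_one] at h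
  have hY_hi : v s₂ ≤ (v b)⁻¹ := by
    rw [Valuation.map_mul] at h01
    have h := mul_le_mul_right h01 (v b)⁻¹
    rwa [inv_mul_cancel_left₀ hb0, mul_one] at h
  -- lower bounds from the second row
  have hX_lo : v d / v (a * d - b * c) ≤ v s₁ := by
    rw [Valuation.map_div, Valuation.map_mul, div_le_one₀ hzpos, hZ] at h11
    -- v d * v s₂ ≤ v(det) * (v s₁ * v s₂)
    rw [div_le_iff₀ hDpos]
    calc v d = v d * v s₂ * (v s₂)⁻¹ := by rw [mul_inv_cancel_right₀ hy0]
      _ ≤ v (a * d - b * c) * (v s₁ * v s₂) * (v s₂)⁻¹ := by gcongr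
      _ = v s₁ * v (a * d - b * c) := by
          rw [mul_assoc, mul_assoc, mul_inv_cancel₀ hy0, mul_one, mul_comm]
  have hY_lo : v c / v (a * d - b * c) ≤ v s₂ := by
    rw [Valuation.map_div, Valuation.map_mul, div_le_one₀ hzpos, hZ] at h10
    rw [div_le_iff₀ hDpos]
    calc v c = v c * v s₁ * (v s₁)⁻¹ := by rw [mul_inv_cancel_right₀ hx0]
      _ ≤ v (a * d - b * c) * (v s₁ * v s₂) * (v s₁)⁻¹ := by gcongr
      _ = v s₂ * v (a * d - b * c) := by
          rw [mul_comm (v s₁) (v s₂), mul_assoc, mul_assoc, mul_inv_cancel₀ hx0, mul_one, mul_comm]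
  exact ⟨⟨hX_lo, hX_hi⟩, ⟨hY_lo, hY_hi⟩, hZ⟩

/-- **the box count** in the additive picture: the pairs of exponents `(x, y) ∈ ℤ²` with `m₁ ≤ x ≤ n₁`,
`m₂ ≤ y ≤ n₂` number `(n₁ - m₁ + 1)₊ · (n₂ - m₂ + 1)₊`. -/
theorem card_box (m₁ n₁ m₂ n₂ : ℤ) :
    ((Finset.Icc m₁ n₁) ×ˢ (Finset.Icc m₂ n₂)).card = (n₁ + 1 - m₁).toNat * (n₂ + 1 - m₂).toNat := by
  rw [Finset.card_product, Int.card_Icc, Int.card_Icc]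

section DiscreteCount

open WithZero Multiplicative

/-- the additive order of a non-zero value of a discrete valuation (`ℤᵐ⁰ = WithZero (Multiplicative ℤ)`). -/
noncomputable def ord {X : WithZero (Multiplicative ℤ)} (hX : X ≠ 0) : ℤ := toAdd (unzero hX)

/-- the order is monotone between non-zero values. -/
theorem ord_le_ord {X Y : WithZero (Multiplicative ℤ)} (hX : X ≠ 0) (hY : Y ≠ 0) (h : X ≤ Y) :
    ord hX ≤ ord hY := by
  unfold ord
  rw [toAdd_le]
  rwa [← coe_unzero hX, ← coe_unzero hY, coe_le_coe] at h

/-- **the interval count of a discrete valuation**: the non-zero values `X` with `lo ≤ X ≤ hi` are at most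
`(ord hi + 1 − ord lo)₊` in number (they inject into `Finset.Icc (ord lo) (ord hi)` by the order). -/
theorem ncard_Icc_le (lo hi : WithZero (Multiplicative ℤ)) (hlo : lo ≠ 0) (hhi : hi ≠ 0) :
    {X : WithZero (Multiplicative ℤ) | lo ≤ X ∧ X ≤ hi}.ncard ≤ (ord hhi + 1 - ord hlo).toNat := by
  classical
  have hmem : ∀ X ∈ {X : WithZero (Multiplicative ℤ) | lo ≤ X ∧ X ≤ hi}, X ≠ 0 := by
    rintro X ⟨h1, -⟩ hX0
    rw [hX0] at h1
    exact hlo (le_antisymm h1 zero_le)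
  -- the injection `X ↦ ord X` into the integer interval
  let f : WithZero (Multiplicative ℤ) → ℤ := fun X => if h : X ≠ 0 then ord h else 0
  have hmaps : ∀ X ∈ {X : WithZero (Multiplicative ℤ) | lo ≤ X ∧ X ≤ hi},
      f X ∈ (Finset.Icc (ord hlo) (ord hhi) : Set ℤ) := by
    rintro X ⟨h1, h2⟩
    have hX : X ≠ 0 := hmem X ⟨h1, h2⟩
    simp only [f, dif_pos hX, Finset.coe_Icc, Set.mem_Icc]
    exact ⟨ord_le_ord hlo hX h1, ord_le_ord hX hhi h2⟩
  have hinj : Set.InjOn f {X : WithZero (Multiplicative ℤ) | lo ≤ X ∧ X ≤ hi} := by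
    intro X hX Y hY hXY
    have hX0 : X ≠ 0 := hmem X hX
    have hY0 : Y ≠ 0 := hmem Y hY
    simp only [f, dif_pos hX0, dif_pos hY0, ord] at hXY
    have h1 : unzero hX0 = unzero hY0 := toAdd.injective hXY
    rw [← coe_unzero hX0, ← coe_unzero hY0, h1]
  have h := Set.ncard_le_ncard_of_injOn f hmaps hinj (Finset.finite_toSet _)
  rwa [Set.ncard_coe_finset, Int.card_Icc] at h

/-- **the box count for a discrete valuation**: the value pairs `(X, Y)` with `lo₁ ≤ X ≤ hi₁`, `lo₂ ≤ Y ≤ hi₂`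
number at most `(ord hi₁ + 1 − ord lo₁)₊ · (ord hi₂ + 1 − ord lo₂)₊`. -/
theorem ncard_box_le (lo₁ hi₁ lo₂ hi₂ : WithZero (Multiplicative ℤ)) (hlo₁ : lo₁ ≠ 0) (hhi₁ : hi₁ ≠ 0)
    (hlo₂ : lo₂ ≠ 0) (hhi₂ : hi₂ ≠ 0) :
    ({X : WithZero (Multiplicative ℤ) | lo₁ ≤ X ∧ X ≤ hi₁} ×ˢ
        {Y : WithZero (Multiplicative ℤ) | lo₂ ≤ Y ∧ Y ≤ hi₂}).ncard ≤
      (ord hhi₁ + 1 - ord hlo₁).toNat * (ord hhi₂ + 1 - ord hlo₂).toNat := by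
  rw [Set.ncard_prod]
  exact Nat.mul_le_mul (ncard_Icc_le lo₁ hi₁ hlo₁ hhi₁) (ncard_Icc_le lo₂ hi₂ hlo₂ hhi₂)

/-- **the split-place support is a box of a discrete valuation**: for `v : Valuation F ℤᵐ⁰` and `γ` with non-zero
entries and determinant, the value pair `(v s₁, v s₂)` of every `(t, s)` with `t⁻¹ γ s ∈ GL₂(O)` lies in the
product of the two intervals `[v d / v det, (v a)⁻¹]`, `[v c / v det, (v b)⁻¹]`, whose point count is
`(1 + e₁)(1 + e₂)`-bounded by `ncard_box_le` — the finite factor of §2c at a general `γ` is a box count. -/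
theorem valuePair_mem_box (v : Valuation F (WithZero (Multiplicative ℤ))) (a b c d t₂ s₁ s₂ : F)
    (ha : a ≠ 0) (hb : b ≠ 0) (hdet : a * d - b * c ≠ 0)
    (ht : t₂ ≠ 0) (hs₁ : s₁ ≠ 0) (hs₂ : s₂ ≠ 0)
    (hK : MemK v (diagonal ![1, t₂⁻¹] * !![a, b; c, d] * diagonal ![s₁, s₂])) :
    (v s₁, v s₂) ∈ ({X : WithZero (Multiplicative ℤ) | v d / v (a * d - b * c) ≤ X ∧ X ≤ (v a)⁻¹} ×ˢ
        {Y : WithZero (Multiplicative ℤ) | v c / v (a * d - b * c) ≤ Y ∧ Y ≤ (v b)⁻¹}) := by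
  obtain ⟨⟨h1, h2⟩, ⟨h3, h4⟩, -⟩ := mem_box_of_mem_K v a b c d t₂ s₁ s₂ ha hb hdet ht hs₁ hs₂ hK
  exact ⟨⟨h1, h2⟩, ⟨h3, h4⟩⟩

end DiscreteCount

end Summit.Ventures.HodgeRepro2.Tier7.Line3.SplitOrbitBox
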